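import Summits.CriticalPhenomena.SAWScalingLimit.Theorems.SAWDevelopingMapObservableToSLECanonicalTransferEscape
import HarnessLib

/-!
# Crux `SAWDevelopingMap.ObservableToSLE` (stmt-CriticalPhenomena-10472), line
`floor-ratio-restriction-bootstrap`, stub `stub_canonicalTransfer`: the escape lemma with
FLOOR-FRIENDLY depth (inner admissible discretisation (M1))

Landing target:
`Summits/CriticalPhenomena/SAWScalingLimit/Theorems/SAWDevelopingMapObservableToSLECanonicalTransferEscapeFloor.lean`
(`--supports stmt-CriticalPhenomena-10472`).  Sequel of `…CanonicalTransferEscape.lean`.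

The inner admissible families are built from the deep vertices with depth measured only ABOVE the
floor line (`closedBall (δ c_u) r ∩ {Im > h} ⊆ Ω ∪ B(p₀, ϱ) ∪ B(p₁, ϱ)`), so that the whole
floor row of a flat floor belongs to the family — this is what makes the inner family of a floor
SUPER-domain contain the canonical walks of the domain (canonical insensitivity (CI)).  The escape
lemma for this depth (registered sub-goal `stub_canonicalTransfer_escapeFloor`) is proved here from
the route lemmas of `…CanonicalTransferEscape.lean` applied to the extended protective set
`U ∪ {Im ≤ h}`.
-/

noncomputable section

open scoped Topology
open Filter Set Metric
open Literature.Probability.LatticeModels (HexVertex hexGraph hexCenter Site)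
open Literature.Probability.RandomPlanarGeometry
open Literature.Probability.RandomPlanarGeometry.SAW
open Literature.Probability.Percolation (PathIn)

namespace Summit.CriticalPhenomena.SAWScalingLimit.Theorems.ObservableToSLE.FloorRatio

/-! ### The escape lemma, floor-friendly depth -/

section EscapeFloor

/-- **Escape of non-deep vertices, floor-friendly depth.**  As `exists_pathIn_escape`, but with
the depth of a vertex measured only ABOVE the floor line: `S` consists of vertices `u` with
`δ c_u ∈ Ω`, height `≥ η`, and `closedBall (δ c_u) r ∩ {Im > h} ⊆ Ω ∪ B(p₀, ϱ) ∪ B(p₁, ϱ)` (so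
the floor row of a flat floor is deep).  Every vertex violating one of these conditions is
joined outside `S` to a vertex at height `≤ h - 5δ`: witnesses are now non-domain points STRICTLY
ABOVE the floor line outside the floor discs; the exterior path from a witness is followed until
its first arrival on the floor line or on a floor disc (which, for an exterior point, can only
happen on the line), and the lattice walk shadows the OPEN initial piece of the path.
[folklore] -/
theorem exists_pathIn_escape_floor {Ω : Set ℂ} {h ρ ϱ δ r η : ℝ} {p₀ p₁ : ℂ} {S : Set HexVertex}
    (hΩh : Ω ⊆ {z : ℂ | h < z.im}) (hE : IsConnected (closure Ω)ᶜ)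
    (hEfr : frontier (closure Ω)ᶜ = frontier Ω)
    (hfl₀ : {z : ℂ | h < z.im} ∩ ball p₀ ρ ⊆ Ω) (hfl₁ : {z : ℂ | h < z.im} ∩ ball p₁ ρ ⊆ Ω)
    (hϱρ : ϱ + δ ≤ ρ) (hδ : 0 < δ) (hr : 25 * δ ≤ r)
    (hS : ∀ u ∈ S, (δ : ℂ) * hexCenter u ∈ Ω ∧ η ≤ ((δ : ℂ) * hexCenter u).im ∧
      closedBall ((δ : ℂ) * hexCenter u) r ∩ {z : ℂ | h < z.im} ⊆ Ω ∪ ball p₀ ϱ ∪ ball p₁ ϱ)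
    {v : HexVertex}
    (hv : ¬ ((δ : ℂ) * hexCenter v ∈ Ω ∧ η ≤ ((δ : ℂ) * hexCenter v).im ∧
      closedBall ((δ : ℂ) * hexCenter v) r ∩ {z : ℂ | h < z.im} ⊆ Ω ∪ ball p₀ ϱ ∪ ball p₁ ϱ)) :
    ∃ w : HexVertex, ((δ : ℂ) * hexCenter w).im ≤ h - 5 * δ ∧ PathIn hexGraph Sᶜ v w := by
  -- the extended protective set: witnesses are points outside `U'`
  set U' : Set ℂ := (Ω ∪ ball p₀ ϱ ∪ ball p₁ ϱ) ∪ {z : ℂ | z.im ≤ h} with hU'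
  have hSU : ∀ u ∈ S, closedBall ((δ : ℂ) * hexCenter u) r ⊆ U' := by
    intro u hu x hx
    by_cases hxim : h < x.im
    · exact Or.inl ((hS u hu).2.2 ⟨hx, hxim⟩)
    · exact Or.inr (not_lt.1 hxim)
  have hflat : ∀ z : ℂ, z ∉ Ω → (dist z p₀ < ρ ∨ dist z p₁ < ρ) → z.im ≤ h := by
    intro z hzΩ hz
    by_contra hzh
    push Not at hzh
    rcases hz with hz | hz
    · exact hzΩ (hfl₀ ⟨hzh, hz⟩)
    · exact hzΩ (hfl₁ ⟨hzh, hz⟩)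
  -- THE WITNESS ROUTE: from a vertex within `r` of a point `y ∉ U'`
  have key : ∀ (v : HexVertex) (y : ℂ), y ∉ U' → dist ((δ : ℂ) * hexCenter v) y ≤ r →
      ∃ w : HexVertex, ((δ : ℂ) * hexCenter w).im ≤ h - 5 * δ ∧ PathIn hexGraph Sᶜ v w := by
    intro v y hyU hvy
    have hyΩ : y ∉ Ω := fun h' => hyU (Or.inl (Or.inl (Or.inl h')))
    have hyim : h < y.im := by
      by_contra h'
      exact hyU (Or.inr (not_lt.1 h'))
    -- (b) descend towards the witness
    obtain ⟨z₁, hz₁y, hvz₁⟩ := exists_pathIn_towards hδ hSU hyU hvy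
    -- (c) an exterior point next to the witness, still above the floor line
    obtain ⟨e, heE, hey⟩ := exists_mem_compl_closure_near hEfr hyΩ (lt_min hδ (sub_pos.2 hyim))
    have heyδ : dist e y < δ := hey.trans_le (min_le_left _ _)
    have heim : h < e.im := by
      have h1 : y.im - e.im ≤ dist e y := by
        rw [dist_comm, dist_eq_norm, ← Complex.sub_im]; exact Complex.im_le_norm _
      linarith [hey.trans_le (min_le_right _ _)]
    -- the stopping set: the closed lower half-plane and the closed floor discs
    set Sx : Set ℂ := {z : ℂ | z.im ≤ h} ∪ closedBall p₀ ϱ ∪ closedBall p₁ ϱ with hSx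
    have hSxc : IsClosed Sx :=
      ((isClosed_le Complex.continuous_im continuous_const).union isClosed_closedBall).union
        isClosed_closedBall
    have hintSx : {z : ℂ | z.im < h} ∪ (ball p₀ ϱ ∪ ball p₁ ϱ) ⊆ interior Sx :=
      interior_maximal (union_subset (fun z hz => Or.inl (Or.inl (show z.im ≤ h from le_of_lt hz)))
        (union_subset (fun z hz => Or.inl (Or.inr (ball_subset_closedBall hz)))
          fun z hz => Or.inr (ball_subset_closedBall hz)))
        ((isOpen_lt Complex.continuous_im continuous_const).union (isOpen_ball.union isOpen_ball))
    -- exterior points above the floor line are outside `Sx`, and outside `U'`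
    have hExt : ∀ z : ℂ, z ∈ (closure Ω)ᶜ → h < z.im → z ∉ Sx ∧ z ∉ U' := by
      intro z hzE hzim
      have hzΩ : z ∉ Ω := fun h' => hzE (subset_closure h')
      have hz₀ : ¬ dist z p₀ < ρ := fun h' => (hflat z hzΩ (Or.inl h')).not_gt hzim
      have hz₁ : ¬ dist z p₁ < ρ := fun h' => (hflat z hzΩ (Or.inr h')).not_gt hzim
      refine ⟨?_, ?_⟩
      · rintro ((h' | h') | h')
        · exact absurd hzim (not_lt.2 h')
        · exact hz₀ ((mem_closedBall.1 h').trans_lt (by linarith))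
        · exact hz₁ ((mem_closedBall.1 h').trans_lt (by linarith))
      · rintro (((h' | h') | h') | h')
        · exact hzΩ h'
        · exact hz₀ ((mem_ball.1 h').trans_le (by linarith))
        · exact hz₁ ((mem_ball.1 h').trans_le (by linarith))
        · exact absurd hzim (not_lt.2 h')
    have heS : e ∉ Sx := (hExt e heE heim).1
    -- follow an exterior path from `e` until it first enters `Sx`
    set q : ℂ := ⟨y.re, h - 6 * δ - 1⟩ with hq
    have hclΩ : closure Ω ⊆ {z : ℂ | h ≤ z.im} := by
      rw [← Complex.closure_setOf_lt_im]; exact closure_mono hΩh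
    have hqE : q ∈ (closure Ω)ᶜ := by
      intro hqc
      have : h ≤ q.im := hclΩ hqc
      simp [hq] at this
      linarith
    have hqS : q ∈ Sx := Or.inl (Or.inl (by show q.im ≤ h; simp [hq]; linarith))
    have hEo : IsOpen (closure Ω)ᶜ := isClosed_closure.isOpen_compl
    have hpc : IsPathConnected (closure Ω)ᶜ := hEo.isConnected_iff_isPathConnected.1 hE
    have hJ : JoinedIn (closure Ω)ᶜ e q := hpc.joinedIn e heE q hqE
    set γ : Path e q := hJ.somePath with hγ
    have hγE : ∀ s : ℝ, γ.extend s ∈ (closure Ω)ᶜ := by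
      intro s
      have : γ.extend s ∈ range γ := by rw [← γ.extend_range]; exact mem_range_self s
      obtain ⟨t, ht⟩ := this
      rw [← ht]
      exact hJ.somePath_mem t
    obtain ⟨t, ht01, hpt, hpint, hbefore⟩ := exists_first_entry hSxc γ heS hqS
    set p : ℂ := γ.extend t with hp
    have ht0 : 0 < t := by
      rcases eq_or_lt_of_le ht01.1 with h0 | h0
      · exfalso
        apply heS
        rw [← γ.extend_zero, h0]
        exact hpt
      · exact h0
    -- the entry point is ON the floor line
    have hpim : p.im ≤ h := by
      by_contra h'
      exact (hExt p (hγE t) (not_le.1 h')).1 hpt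
    -- the OPEN initial piece of the path: exterior points above the floor line
    set P : Set ℂ := γ.extend '' Ico 0 t with hP
    have hPconn : IsPreconnected P := isPreconnected_Ico.image _ γ.continuous_extend.continuousOn
    have hPgood : ∀ z ∈ P, z ∉ U' := by
      rintro _ ⟨s, hs, rfl⟩
      have hzS : γ.extend s ∉ Sx := hbefore s hs
      refine (hExt _ (hγE s) ?_).2
      by_contra h'
      exact hzS (Or.inl (Or.inl (not_lt.1 h')))
    have heP : e ∈ P := ⟨0, ⟨le_rfl, ht0⟩, γ.extend_zero⟩
    -- a point of `P` within `δ` of the entry point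
    obtain ⟨y', hy'P, hy'p⟩ : ∃ y' ∈ P, dist y' p < δ := by
      obtain ⟨ε, hε, hball⟩ := Metric.continuousAt_iff.1 (γ.continuous_extend.continuousAt (x := t)) δ hδ
      set s : ℝ := max 0 (t - ε / 2) with hs
      have hst : s < t := max_lt ht0 (by linarith)
      have hsε : dist s t < ε := by
        rw [Real.dist_eq, abs_sub_lt_iff]
        constructor <;> [linarith; (have := le_max_right 0 (t - ε / 2); linarith)]
      exact ⟨γ.extend s, ⟨s, ⟨le_max_left _ _, hst⟩, rfl⟩, hball hsε⟩
    obtain ⟨z₂, hz₂p⟩ := exists_vertex_dist_le hδ p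
    have hz₁e : dist ((δ : ℂ) * hexCenter z₁) e ≤ 2 * δ := by
      calc dist ((δ : ℂ) * hexCenter z₁) e ≤ dist ((δ : ℂ) * hexCenter z₁) y + dist e y :=
            dist_triangle_right _ _ _
        _ ≤ δ + δ := add_le_add hz₁y heyδ.le
        _ = 2 * δ := by ring
    have hz₂y' : dist ((δ : ℂ) * hexCenter z₂) y' ≤ 2 * δ := by
      calc dist ((δ : ℂ) * hexCenter z₂) y' ≤ dist ((δ : ℂ) * hexCenter z₂) p + dist y' p :=
            dist_triangle_right _ _ _
        _ ≤ δ + δ := add_le_add hz₂p hy'p.le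
        _ = 2 * δ := by ring
    obtain ⟨pw, hpw⟩ := exists_walk_near_of_isPreconnected hPconn hδ (r := 2 * δ) (by linarith)
      heP hy'P hz₁e hz₂y'
    have hz₁z₂ : PathIn hexGraph Sᶜ z₁ z₂ := by
      refine pathIn_of_walk pw fun u hu huS => ?_
      obtain ⟨zz, hzzP, hd⟩ := hpw u hu
      refine hPgood zz hzzP (hSU u huS ?_)
      rw [mem_closedBall, dist_comm]
      linarith
    -- final descent from `z₂`, witnessed by `y'`
    have hz₂im : ((δ : ℂ) * hexCenter z₂).im ≤ h + 3 * δ := by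
      have h1 : ((δ : ℂ) * hexCenter z₂).im - p.im ≤ dist ((δ : ℂ) * hexCenter z₂) p := by
        rw [dist_eq_norm, ← Complex.sub_im]; exact Complex.im_le_norm _
      linarith
    obtain ⟨w, hw, hz₂w⟩ :=
      exists_pathIn_down_of_witness hδ hr hSU (hPgood y' hy'P) hz₂y' hz₂im
    exact ⟨w, hw, (hvz₁.trans hz₁z₂).trans hz₂w⟩
  -- CASE ANALYSIS on the violated condition
  by_cases hvΩ : (δ : ℂ) * hexCenter v ∈ Ω
  · by_cases hη : η ≤ ((δ : ℂ) * hexCenter v).im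
    · have hball : ¬ closedBall ((δ : ℂ) * hexCenter v) r ∩ {z : ℂ | h < z.im} ⊆
          Ω ∪ ball p₀ ϱ ∪ ball p₁ ϱ := fun h' => hv ⟨hvΩ, hη, h'⟩
      obtain ⟨y, ⟨hy, hyim⟩, hyU⟩ := not_subset.1 hball
      have hyim' : h < y.im := hyim
      refine key v y ?_ (by rw [dist_comm]; exact mem_closedBall.1 hy)
      rintro (h' | h')
      · exact hyU h'
      · exact absurd hyim' (not_lt.2 h')
    · push Not at hη
      exact exists_pathIn_down_of_height hδ fun u hu => hη.trans_le (hS u hu).2.1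
  · by_cases hvim : ((δ : ℂ) * hexCenter v).im ≤ h
    · exact exists_pathIn_down_of_height hδ fun u hu => hvim.trans_lt (hΩh (hS u hu).1)
    · push Not at hvim
      have hb : (δ : ℂ) * hexCenter v ∉ ball p₀ ϱ ∪ ball p₁ ϱ := by
        rintro (hb | hb)
        · exact hvim.not_ge (hflat _ hvΩ (Or.inl ((mem_ball.1 hb).trans_le (by linarith))))
        · exact hvim.not_ge (hflat _ hvΩ (Or.inr ((mem_ball.1 hb).trans_le (by linarith))))
      refine key v ((δ : ℂ) * hexCenter v) ?_ (by rw [dist_self]; linarith)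
      rintro (((h' | h') | h') | h')
      · exact hvΩ h'
      · exact hb (Or.inl h')
      · exact hb (Or.inr h')
      · exact hvim.not_ge h'

end EscapeFloor

/-- **Registered sub-goal `stub_canonicalTransfer_escapeFloor`** (crux item stmt-CriticalPhenomena-10472,
stub `stub_canonicalTransfer`): the floor-friendly escape lemma, registry form of
`exists_pathIn_escape_floor`. [folklore] -/
theorem stub_canonicalTransfer_escapeFloor :
    ∀ (Ω : Set ℂ) (h ρ ϱ δ r η : ℝ) (p₀ p₁ : ℂ) (S : Set HexVertex) (v : HexVertex),
    Ω ⊆ {z : ℂ | h < z.im} → IsConnected (closure Ω)ᶜ → frontier (closure Ω)ᶜ = frontier Ω →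
    {z : ℂ | h < z.im} ∩ ball p₀ ρ ⊆ Ω → {z : ℂ | h < z.im} ∩ ball p₁ ρ ⊆ Ω →
    ϱ + δ ≤ ρ → 0 < δ → 25 * δ ≤ r →
    (∀ u ∈ S, (δ : ℂ) * hexCenter u ∈ Ω ∧ η ≤ ((δ : ℂ) * hexCenter u).im ∧
      closedBall ((δ : ℂ) * hexCenter u) r ∩ {z : ℂ | h < z.im} ⊆ Ω ∪ ball p₀ ϱ ∪ ball p₁ ϱ) →
    ¬ ((δ : ℂ) * hexCenter v ∈ Ω ∧ η ≤ ((δ : ℂ) * hexCenter v).im ∧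
      closedBall ((δ : ℂ) * hexCenter v) r ∩ {z : ℂ | h < z.im} ⊆ Ω ∪ ball p₀ ϱ ∪ ball p₁ ϱ) →
    ∃ w : HexVertex, ((δ : ℂ) * hexCenter w).im ≤ h - 5 * δ ∧ PathIn hexGraph Sᶜ v w :=
  fun _ _ _ _ _ _ _ _ _ _ _ hΩh hE hEfr hfl₀ hfl₁ hϱρ hδ hr hS hv =>
    exists_pathIn_escape_floor hΩh hE hEfr hfl₀ hfl₁ hϱρ hδ hr hS hv

end Summit.CriticalPhenomena.SAWScalingLimit.Theorems.ObservableToSLE.FloorRatio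

end
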